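import Summits.ResolutionOfSingularities.ResolutionOfSingularities.Theorems.SeparableGaloisGaloisQuotientModelsReduction
import HarnessLib

/-!
# Crux `GaloisQuotientModels` (stmt-ResolutionOfSingularities-18955) — line `inseparability-foliation-quotient`
# (lead's skeleton, reshaped 2026-08-17: vocabulary = `Theorems/SeparableGaloisGaloisQuotientModelsDefs.lean`,
# stubs with explicit binders)

Route `ResolutionOfSingularities/SeparableGalois`, crux W (rank 2): over a PERFECT field of
characteristic `p`, every integral separated finite-type `X` has a proper BIRATIONAL `X₁ → X` with
`X₁ = X'/G` the Galois-type quotient of a REGULAR `X'` (de Jong's Galois alteration with the purely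
inseparable defect removed).

## The line (card `Ideas/inseparability-foliation-quotient.md`, merged with
`Ideas/inseparability-foliation-sandwich.md` by the triage panel 3/3; planner's skeleton
`Lines/inseparability_foliation_quotient.lean` @3dca864a2d0b)

Keep de Jong's Galois alteration `(X₁, G, π : X₁ → X)` (`K(X₁)^G ⊇ K(X)` purely inseparable of
exponent `n`) and DIVIDE OUT the defect downwards: the Frobenius compositum
`Mₙ := K(X)·K(X₁)^{pⁿ} ⊆ K(X₁)` is `G`-stable with `Mₙ ∩ K(X₁)^G = K(X)` (stub 2, field theory), its
normal model under `X₁` — the infinitesimal quotient `Z = X₁/F` of `X₁` by the level-`n`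
inseparability foliation, `𝒪_Z = 𝒪_{X₁} ∩ Mₙ` (stub 3, a construction) — is, BY THE CARD'S CONJECTURE
"MULT", a Zariski LOG REGULAR scheme on which `G` acts by log automorphisms (stub 1, the research
content, packaged existentially with de Jong 1997 Thm. 5.13), Kato–Nizioł log blow-ups chosen
`G`-invariantly give a REGULAR `X'` with a `G`-action, `G`-equivariantly proper birational over `Z`
(stub 4), whence `K(X')^G = Mₙ^G = K(X)`: a regular SEPARABLE Galois top; the SGA 1 V.1 quotient
`X'/G → X` is then proper BIRATIONAL and is the witness block of W (stub 5).

## State after cycle 1 (this file, skeleton v5)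

* LANDED: stub 2 `stub_frobeniusCompositum` (p165291), stub 3 `stub_sandwichModel` (p168617, with six
  Literature files: SubringSpecAut, SubringSpecStalks, GermSubfieldSpec, FiniteGroupQuotientFinsetAffine,
  GaloisAlterationSandwichBase, SandwichModel), stub 5 `stub_quotientModel` (p165201), the Chow cover
  `Resolution.exists_isBirational_finsetsInAffineOpens` (p168994), and the sorry-free COMPOSITION
  `galoisQuotientModels_of_multiplicativeDefect_of_equivariantLogResolution : MD → ELR → W`
  (`Theorems/SeparableGaloisGaloisQuotientModelsReduction.lean`, p169156).
* OPEN: stub 1 `stub_multiplicativeDefect` (MD = de Jong 1997 Thm. 5.13 datum + the conjecture MULT;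
  crux-sized) and stub 4 `stub_equivariantLogResolution` (ELR = the named fact
  `IllusieTemkin2014_equivariantLogRegularResolution`, vendored p166098; the conditional proof
  `stub_equivariantLogResolution_of_illusieTemkin2014` is landed, p166763, and
  `galoisQuotientModels_of_illusieTemkin2014_of_multiplicativeDefect : IT-fact → MD → W` too).

## Reshape history (lead)

* The vocabulary (`GaloisQuotientConclusion`, `frobeniusCompositum`, `IsGaloisAlterationOfExponent`,
  `IsSandwichModel`, `IsLogEquivariant`, `HasSeparableGaloisTop`) lives in the route's Defs file
  `Theorems/SeparableGaloisGaloisQuotientModelsDefs.lean` (p163234, ACCEPTED), imported here and by every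
  stub file `Theorems/SeparableGaloisGaloisQuotientModels<Stub>.lean` (same namespace
  `…Theorems.GaloisQuotientModels`, so the registered signatures read unqualified).
* The five stubs are stated with explicit binders (no `Sig.*` layer); `[Fact p.Prime]` and instance
  binders replace the named hypotheses; `PerfectField k` is dropped from stub 3 (idle there).
* `GaloisQuotientModels_of` takes the five statements as hypotheses and is kernel-checked (no `sorry`
  of its own); `GaloisQuotientModels_proof` plugs the stubs in and concludes the route decl BY NAME.

Disproof used (`Cruxes/GaloisQuotientModels/Disproof.lean`, cdisprove v2, re-read 2026-08-17T13:10Z):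
W ⟸ summit (the line is a proof architecture); `galoisQuotientModels_false_without_isIntegral` /
`…_without_locallyOfFiniteType` honoured (`IsIntegral X`, `LocallyOfFiniteType f` are consumed by
stubs 1, 3, 5); §B `hasResolution_of_etale_presentation`: the output `q : X' → X'/G` IS ramified along
the fixed divisors; §D targets concern the dead `Sketch` line only; no `Negative/*` lemma applies.
-/

noncomputable section

-- single-problem summit: the doubled namespace component `ResolutionOfSingularities` is forced
set_option linter.dupNamespace false

open CategoryTheory AlgebraicGeometry TopologicalSpace
open Literature.AlgebraicGeometry.Resolution
open Literature.AlgebraicGeometry.Motives Literature.AlgebraicGeometry.Motives.RatFn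

namespace Summit.ResolutionOfSingularities.ResolutionOfSingularities.Theorems.GaloisQuotientModels

open Summit.ResolutionOfSingularities.ResolutionOfSingularities.Theses.SeparableGalois (GaloisQuotientModels)

/-! ## The two OPEN stub statements by name (`Sig.stub_<name>`, skeleton-local: the skeleton theorem
`GaloisQuotientModels_of` must take its hypotheses BY NAME; the stub theorems below restate them with
explicit binders, definitionally equal). Stubs 2, 3, 5 are LANDED theorems (imported):
`stub_frobeniusCompositum` (p165291), `stub_sandwichModel` (p168617), `stub_quotientModel` (p165201);
stub 4 is proved CONDITIONALLY on the named fact `IllusieTemkin2014_equivariantLogRegularResolution`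
(`stub_equivariantLogResolution_of_illusieTemkin2014`, p166763) and stays a stub here. -/

/-- Statement of `stub_multiplicativeDefect`. [cite: DeJong1997, Thm. 5.13] -/
def Sig.stub_multiplicativeDefect : Prop :=
  ∀ (p : ℕ) [Fact p.Prime] (k : Type) [Field k] [CharP k p] [PerfectField k]
    (X : Scheme.{0}) [IsIntegral X] (f : X ⟶ Spec (.of k)) [IsSeparated f]
    [LocallyOfFiniteType f] [QuasiCompact f],
    ∃ (G : Type) (_ : Group G) (_ : Finite G) (X₁ : Scheme.{0}) (_ : IsIntegral X₁)
      (ρ : G →* Aut X₁) (π : X₁ ⟶ X) (_ : IsDominant π) (n : ℕ),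
      IsGaloisAlterationOfExponent p n ρ π ∧
      ∀ (Z : Scheme.{0}) [IsIntegral Z] (ρZ : G →* Aut Z) (u : X₁ ⟶ Z) [IsDominant u]
        (v : Z ⟶ X), IsSandwichModel p n ρ π ρZ u v →
        ∃ 𝒜 : LogAtlas.{0} Z, 𝒜.IsLogRegular ∧ IsLogEquivariant 𝒜 ρZ

/-- Statement of `stub_equivariantLogResolution`. [cite: Niziol2006, Thm. 5.8 and 5.10]
[cite: Kato1994, (10.4)] -/
def Sig.stub_equivariantLogResolution : Prop :=
  ∀ (Z : Scheme.{0}) [IsIntegral Z] [CompactSpace Z] (𝒜 : LogAtlas.{0} Z) (G : Type)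
    [Group G] [Finite G] (ρZ : G →* Aut Z), 𝒜.IsLogRegular → IsLogEquivariant 𝒜 ρZ →
    (∀ S : Finset Z, ∃ U : Z.Opens, IsAffineOpen U ∧ (↑S : Set Z) ⊆ U) →
    ∃ (X' : Scheme.{0}) (_ : IsIntegral X') (ρ' : G →* Aut X') (r : X' ⟶ Z) (_ : IsDominant r),
      IsProper r ∧ IsBirational r ∧ Scheme.IsRegular X' ∧
      (∀ g : G, (ρ' g).hom ≫ r = r ≫ (ρZ g).hom) ∧
      (∀ S : Finset X', ∃ U : X'.Opens, IsAffineOpen U ∧ (↑S : Set X') ⊆ U) ∧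
      Function.Bijective (functionFieldMap r) ∧
      (Function.Injective ρZ → Function.Injective ρ')

/-! ## The two open stubs (registered on stmt-ResolutionOfSingularities-18955; explicit binders) -/

/-- **STUB 1 — THE HARDEST (held by the lead): de Jong 1997 Thm. 5.13 datum + the line's conjecture
MULT, prime by prime.** Over a PERFECT field of characteristic `p`, every integral separated
finite-type `X` admits a de Jong datum `(G, X₁, ρ, π, n)` (`IsGaloisAlterationOfExponent`) every
normal level-`n` sandwich model `Z` of which carries a log regular fs Zariski atlas on which `G` acts
by log automorphisms. The datum half is the named fact `DeJong1997_galoisAlterationQuasiProjective`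
(plus a uniform exponent, from finiteness of `K(X₁)/K(X)`); MULT is the research content (size XL +
open; cheapest falsifier: one additive point of the inseparability foliation on a genuine de Jong
output). [cite: DeJong1997, Thm. 5.13] [cite: arXiv:2311.16694, Prop. 5] -/
theorem stub_multiplicativeDefect (p : ℕ) [Fact p.Prime] (k : Type) [Field k] [CharP k p]
    [PerfectField k] (X : Scheme.{0}) [IsIntegral X] (f : X ⟶ Spec (.of k)) [IsSeparated f]
    [LocallyOfFiniteType f] [QuasiCompact f] :
    ∃ (G : Type) (_ : Group G) (_ : Finite G) (X₁ : Scheme.{0}) (_ : IsIntegral X₁)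
      (ρ : G →* Aut X₁) (π : X₁ ⟶ X) (_ : IsDominant π) (n : ℕ),
      IsGaloisAlterationOfExponent p n ρ π ∧
      ∀ (Z : Scheme.{0}) [IsIntegral Z] (ρZ : G →* Aut Z) (u : X₁ ⟶ Z) [IsDominant u]
        (v : Z ⟶ X), IsSandwichModel p n ρ π ρZ u v →
        ∃ 𝒜 : LogAtlas.{0} Z, 𝒜.IsLogRegular ∧ IsLogEquivariant 𝒜 ρZ := by
  sorry

/-- **STUB 4 (named-fact level, size L–XL): equivariant Kato–Nizioł resolution of log regular
schemes.** A quasi-compact integral scheme with a log regular fs Zariski atlas and a finite group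
acting by log automorphisms, finite subsets in affine opens, admits a REGULAR integral `X'` with a
`G`-action and a `G`-equivariant proper birational `r : X' → Z`, finite subsets of `X'` in affine opens,
`r♯` bijective, faithfulness preserved. In print: Kato 1994 (10.4) (in tree as the named fact
`Kato1994_logRegularScheme_hasResolution`, non-equivariant) with Nizioł 2006 Thm. 5.8 / 5.10 (canonical,
hence automorphism-compatible, regular subdivision of the fan). [cite: Niziol2006, Thm. 5.8 and 5.10]
[cite: Kato1994, (10.4) with (9.8), (9.11), (10.3)] -/
theorem stub_equivariantLogResolution (Z : Scheme.{0}) [IsIntegral Z] [CompactSpace Z]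
    (𝒜 : LogAtlas.{0} Z) (G : Type) [Group G] [Finite G] (ρZ : G →* Aut Z) (h𝒜 : 𝒜.IsLogRegular)
    (heqv : IsLogEquivariant 𝒜 ρZ)
    (haff : ∀ S : Finset Z, ∃ U : Z.Opens, IsAffineOpen U ∧ (↑S : Set Z) ⊆ U) :
    ∃ (X' : Scheme.{0}) (_ : IsIntegral X') (ρ' : G →* Aut X') (r : X' ⟶ Z) (_ : IsDominant r),
      IsProper r ∧ IsBirational r ∧ Scheme.IsRegular X' ∧
      (∀ g : G, (ρ' g).hom ≫ r = r ≫ (ρZ g).hom) ∧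
      (∀ S : Finset X', ∃ U : X'.Opens, IsAffineOpen U ∧ (↑S : Set X') ⊆ U) ∧
      Function.Bijective (functionFieldMap r) ∧
      (Function.Injective ρZ → Function.Injective ρ') := by
  sorry

/-! ## The composition (landed: `Theorems/SeparableGaloisGaloisQuotientModelsReduction.lean`, p169156) -/

/-- **W from the two open stub statements** — by the landed, kernel-checked composition
`galoisQuotientModels_of_multiplicativeDefect_of_equivariantLogResolution` (Chow reduction; de Jong datum
of MD; stub 2: `Mₙ` is `G`-stable with `Mₙ^G = K(X)`; stub 3: the normal sandwich model; MD: its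
`G`-equivariant log regular atlas; ELR: equivariant resolution `r : X' → Z`; fixed-field chase;
stub 5: the Galois-quotient model). [cite: DeJong1997, Thm. 5.13] -/
theorem GaloisQuotientModels_of (h₁ : Sig.stub_multiplicativeDefect)
    (h₄ : Sig.stub_equivariantLogResolution) : GaloisQuotientModels :=
  galoisQuotientModels_of_multiplicativeDefect_of_equivariantLogResolution h₁ h₄

/-- **The crux, assembled from the registered stubs** (skeleton v5: the only `sorry`s in its closure
are `stub_multiplicativeDefect` (de Jong datum + MULT) and `stub_equivariantLogResolution` (= the
named fact `IllusieTemkin2014_equivariantLogRegularResolution`), none of its own). -/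
theorem GaloisQuotientModels_proof : GaloisQuotientModels :=
  GaloisQuotientModels_of stub_multiplicativeDefect stub_equivariantLogResolution

end Summit.ResolutionOfSingularities.ResolutionOfSingularities.Theorems.GaloisQuotientModels

end
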